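import Summits.AtomisticToContinuum.BoseEinsteinCondensation.Theorems.BECStronglyRayleighLatticeToPeriodicBridgeCoarseCellDefs
import Literature.MathematicalPhysics.QuantumManyBody.PeriodicBoseGasFracEnergy
import Literature.MathematicalPhysics.QuantumManyBody.SwapPurity

/-!
# Crux line `coarse-cell-lorentzian` (stmt-AtomisticToContinuum-9674), stub S3: the cell pair sum rule

The "≥" direction of the flat-cell dictionary between the constant-mode occupation of an
`(N'+2)`-body periodic trial state on the torus of side `L` and the background-integrated mass
`I_r = ∫_{cell^{N'}} Σ_x r_{X'}(x)² dX'` of the cell pair-insertion field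
`r_{X'}(x) = Σ_y K_{X'}(x,y)`, `K_{X'}(x,y) = ∫_{C_x}∫_{C_y} Re Ψ(ξ,η,X') dη dξ`, for the `M³` cubic
cells `C_x` of side `b = L/M`:

  `(N'+2) · M⁻³ · b⁻⁶ · I_r ≤ ⟨Ψ, n₀ Ψ⟩`     (`stub_cellPairSumRule : Sig.stub_cellPairSumRule`).

Proof: `⟨Ψ, n₀Ψ⟩ = (N'+2) L⁻³ ∫_{cell^{N'+1}} |∫_cell Ψ(ξ, Y) dξ|² dY` (`condensateOccupation_succ`);
split `Y = (η, X')` (Tonelli); for fixed `X'`, `∫_{η ∈ cell} = Σ_y ∫_{η ∈ C_y}` (the cells tile the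
fundamental cell), Cauchy–Schwarz on each `C_y` (`|∫_{C_y} h|² ≤ b³ ∫_{C_y} |h|²`), `|z|² ≥ (Re z)²`,
and `Re ∫_{C_y} h = Σ_x ∫_{C_y}∫_{C_x} Re Ψ = Σ_x K_{X'}(y,x) = r_{X'}(y)` by Bose symmetry in the
tagged pair; finally `L⁻³ b⁻³ = M⁻³ b⁻⁶` and `ofReal ∫ ≤ ∫⁻ ofReal`. No reality, positivity or
near-minimiser hypothesis is used. [PenroseOnsager1956; Fournais2020 (1.3)–(1.5)]
-/

noncomputable section

open MeasureTheory Filter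
open scoped ENNReal Topology

namespace Summit.AtomisticToContinuum.BoseEinsteinCondensation.Cruxes.LatticeToPeriodicBridge.CoarseCellLorentzian

open Literature.MathematicalPhysics.QuantumManyBody.BoseGas

namespace CellPairSumRule

/-! ## Generic measure-theoretic lemmas -/

section Generic

/-- `‖∫_s h‖² ≤ |s| · ∫_s ‖h‖²` (Cauchy–Schwarz against the constant `1`). [folklore] -/
theorem sq_nnnorm_setIntegral_le {α : Type*} [MeasurableSpace α] {μ : Measure α} {s : Set α}
    {h : α → ℂ} (hh : AEStronglyMeasurable h (μ.restrict s)) :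
    (‖∫ a in s, h a ∂μ‖₊ : ℝ≥0∞) ^ 2 ≤ μ s * ∫⁻ a in s, (‖h a‖₊ : ℝ≥0∞) ^ 2 ∂μ := by
  have hmeas : AEMeasurable (fun a => (‖h a‖₊ : ℝ≥0∞)) (μ.restrict s) := hh.enorm
  have h1 : (‖∫ a in s, h a ∂μ‖₊ : ℝ≥0∞) ≤ ∫⁻ a in s, (‖h a‖₊ : ℝ≥0∞) ∂μ :=
    enorm_integral_le_lintegral_enorm _
  have h2 := lintegral_mul_sq_le (μ.restrict s) (f := fun _ => (1 : ℝ≥0∞)) aemeasurable_const hmeas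
  simp only [one_mul, one_pow, setLIntegral_const] at h2
  calc (‖∫ a in s, h a ∂μ‖₊ : ℝ≥0∞) ^ 2 ≤ (∫⁻ a in s, (‖h a‖₊ : ℝ≥0∞) ∂μ) ^ 2 := by gcongr
    _ ≤ μ s * ∫⁻ a in s, (‖h a‖₊ : ℝ≥0∞) ^ 2 ∂μ := h2

/-- `ofReal (∫ f) ≤ ∫⁻ ofReal f` for `f ≥ 0` (if `f` is not integrable the left side is `0`).
[folklore] -/
theorem ofReal_integral_le_lintegral_ofReal {α : Type*} [MeasurableSpace α] {μ : Measure α}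
    {f : α → ℝ} (hf : ∀ a, 0 ≤ f a) :
    ENNReal.ofReal (∫ a, f a ∂μ) ≤ ∫⁻ a, ENNReal.ofReal (f a) ∂μ := by
  by_cases hfm : AEStronglyMeasurable f μ
  · rw [integral_eq_lintegral_of_nonneg_ae (Eventually.of_forall hf) hfm]
    exact ENNReal.ofReal_toReal_le
  · rw [integral_non_aestronglyMeasurable hfm, ENNReal.ofReal_zero]
    exact zero_le

variable {n : ℕ}

/-- Measurability of `Y ↦ |∫_Ω Ψ(x, Y) dx|²` for continuous `Ψ`. [folklore] -/
-- adapted from Literature/MathematicalPhysics/QuantumManyBody/PeriodicBoseGasThm31.lean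
theorem measurable_sliceMeanSq (L : ℝ) {Ψ : Config (n + 1) → ℂ} (hΨ : Continuous Ψ) :
    Measurable fun Y : Config n => (‖∫ x in cell L, Ψ (Matrix.vecCons x Y)‖₊ : ℝ≥0∞) ^ 2 := by
  have h : StronglyMeasurable
      (Function.uncurry fun (Y : Config n) (x : Space) => Ψ (Matrix.vecCons x Y)) := by
    refine (hΨ.comp ?_).stronglyMeasurable
    exact continuous_snd.matrixVecCons continuous_fst
  exact ((h.integral_prod_right'
    (ν := volume.restrict (cell L))).measurable.nnnorm.coe_nnreal_ennreal).pow_const _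

variable {L : ℝ}

/-- A continuous function on `ℝ³ × ℝ³` is integrable for the product of the Lebesgue measures
restricted to `s, t ⊆ [0,L)³` (bounded sets). [folklore] -/
theorem integrable_prod_restrict_of_continuous {E : Type*} [NormedAddCommGroup E]
    {G : Space × Space → E} (hG : Continuous G) {s t : Set Space} (hs : s ⊆ cell L)
    (ht : t ⊆ cell L) :
    Integrable G ((volume.restrict s).prod (volume.restrict t)) := by
  rw [Measure.prod_restrict]
  exact ((hG.continuousOn.integrableOn_compact
    ((isCompact_closedBox L).prod (isCompact_closedBox L))).mono_set
    (Set.prod_mono (hs.trans (cell_subset_closedBox L)) (ht.trans (cell_subset_closedBox L))))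

/-- Parametric integrals `η ↦ ∫_{ξ ∈ t} G(η, ξ)` of a continuous `G` are integrable on `s`, for
`s, t ⊆ [0,L)³`. [folklore] -/
theorem integrableOn_setIntegral_of_continuous {E : Type*} [NormedAddCommGroup E] [NormedSpace ℝ E]
    {G : Space × Space → E} (hG : Continuous G) {s t : Set Space} (hs : s ⊆ cell L)
    (ht : t ⊆ cell L) :
    IntegrableOn (fun η => ∫ ξ in t, G (η, ξ)) s volume :=
  (integrable_prod_restrict_of_continuous hG hs ht).integral_prod_left

end Generic

/-! ## The cells `C_x`: measurability, volume, disjointness, tiling of the fundamental cell -/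

section Cells

variable {M : ℕ}

/-- The cell `C_x` is measurable. [folklore] -/
theorem measurableSet_torusCell (M : ℕ) (b : ℝ) (x : Fin 3 → Fin M) :
    MeasurableSet (torusCell M b x) := by
  have h : torusCell M b x = ⋂ k : Fin 3, (fun ξ : Space => ξ k) ⁻¹'
      Set.Ico (((x k : ℕ) : ℝ) * b) ((((x k : ℕ) : ℝ) + 1) * b) := by
    ext ξ; simp [torusCell]
  rw [h]
  exact MeasurableSet.iInter fun k => measurableSet_Ico.preimage (by fun_prop)

/-- `|C_x| = b³`. [folklore] -/
theorem volume_torusCell (M : ℕ) (b : ℝ) (x : Fin 3 → Fin M) :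
    volume (torusCell M b x) = ENNReal.ofReal b ^ 3 := by
  have h : torusCell M b x = (@WithLp.ofLp 2 (Fin 3 → ℝ)) ⁻¹'
      (Set.univ.pi fun k => Set.Ico (((x k : ℕ) : ℝ) * b) ((((x k : ℕ) : ℝ) + 1) * b)) := by
    ext ξ; simp [torusCell]
  rw [h, (PiLp.volume_preserving_ofLp (Fin 3)).measure_preimage
    (MeasurableSet.univ_pi fun _ => measurableSet_Ico).nullMeasurableSet, volume_pi_pi]
  have hk : ∀ k : Fin 3, (((x k : ℕ) : ℝ) + 1) * b - ((x k : ℕ) : ℝ) * b = b := fun k => by ring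
  simp only [Real.volume_Ico, hk, Finset.prod_const, Finset.card_univ, Fintype.card_fin]

/-- Distinct cells are disjoint (`b > 0`). [folklore] -/
theorem pairwise_disjoint_torusCell (M : ℕ) {b : ℝ} (hb : 0 < b) :
    Pairwise (Function.onFun Disjoint fun x : Fin 3 → Fin M => torusCell M b x) := by
  intro x y hxy
  change Disjoint (torusCell M b x) (torusCell M b y)
  refine Set.disjoint_left.2 fun ξ hx hy => hxy ?_
  funext k
  obtain ⟨h1l, h1u⟩ := hx k
  obtain ⟨h2l, h2u⟩ := hy k
  have i1 : ((x k : ℕ) : ℝ) < ((y k : ℕ) : ℝ) + 1 :=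
    lt_of_mul_lt_mul_right (h1l.trans_lt h2u) hb.le
  have i2 : ((y k : ℕ) : ℝ) < ((x k : ℕ) : ℝ) + 1 :=
    lt_of_mul_lt_mul_right (h2l.trans_lt h1u) hb.le
  have i1' : (x k : ℕ) < (y k : ℕ) + 1 := by exact_mod_cast i1
  have i2' : (y k : ℕ) < (x k : ℕ) + 1 := by exact_mod_cast i2
  exact Fin.ext (by omega)

variable {L : ℝ}

/-- Cells of side `L/M` lie in the fundamental cell `[0,L)³`. [folklore] -/
theorem torusCell_subset_cell (hL : 0 < L) (hM : 1 ≤ M) (x : Fin 3 → Fin M) :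
    torusCell M (L / M) x ⊆ cell L := by
  have hMpos : (0 : ℝ) < M := by exact_mod_cast hM
  have hb : 0 < L / M := div_pos hL hMpos
  intro ξ hξ k
  obtain ⟨h1, h2⟩ := hξ k
  refine ⟨le_trans (mul_nonneg (Nat.cast_nonneg _) hb.le) h1, ?_⟩
  have hx : ((x k : ℕ) : ℝ) + 1 ≤ M := by exact_mod_cast (x k).isLt
  calc ξ k < (((x k : ℕ) : ℝ) + 1) * (L / M) := h2
    _ ≤ (M : ℝ) * (L / M) := mul_le_mul_of_nonneg_right hx hb.le
    _ = L := by field_simp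

/-- **Tiling.** For `0 < L` and `1 ≤ M` the `M³` cells of side `L/M` cover `[0,L)³` exactly
(for `t ∈ [0,L)` the index is `⌊t/(L/M)⌋₊ < M`). [folklore] -/
theorem cell_eq_iUnion_torusCell (hL : 0 < L) (hM : 1 ≤ M) :
    cell L = ⋃ x : Fin 3 → Fin M, torusCell M (L / M) x := by
  have hMpos : (0 : ℝ) < M := by exact_mod_cast hM
  have hb : 0 < L / M := div_pos hL hMpos
  refine Set.Subset.antisymm (fun ξ hξ => ?_)
    (Set.iUnion_subset fun x => torusCell_subset_cell hL hM x)
  have hj : ∀ k, ⌊ξ k / (L / M)⌋₊ < M := fun k => by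
    rw [Nat.floor_lt (div_nonneg (hξ k).1 hb.le), div_lt_iff₀ hb]
    calc ξ k < L := (hξ k).2
      _ = (M : ℝ) * (L / M) := by field_simp
  refine Set.mem_iUnion.2 ⟨fun k => ⟨⌊ξ k / (L / M)⌋₊, hj k⟩, fun k => ⟨?_, ?_⟩⟩
  · calc (((⌊ξ k / (L / M)⌋₊ : ℕ) : ℝ)) * (L / M) ≤ ξ k / (L / M) * (L / M) :=
        mul_le_mul_of_nonneg_right (Nat.floor_le (div_nonneg (hξ k).1 hb.le)) hb.le
      _ = ξ k := div_mul_cancel₀ _ hb.ne'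
  · calc ξ k = ξ k / (L / M) * (L / M) := (div_mul_cancel₀ _ hb.ne').symm
      _ < (((⌊ξ k / (L / M)⌋₊ : ℕ) : ℝ) + 1) * (L / M) :=
        mul_lt_mul_of_pos_right (Nat.lt_floor_add_one _) hb

/-- `∫_{[0,L)³} f = Σ_x ∫_{C_x} f` for `f` integrable on the cell. [folklore] -/
theorem setIntegral_cell_eq_sum (hL : 0 < L) (hM : 1 ≤ M) {f : Space → ℝ}
    (hf : IntegrableOn f (cell L) volume) :
    ∫ ξ in cell L, f ξ = ∑ x : Fin 3 → Fin M, ∫ ξ in torusCell M (L / M) x, f ξ := by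
  have hMpos : (0 : ℝ) < M := by exact_mod_cast hM
  have hsub := fun x : Fin 3 → Fin M => hf.mono_set (torusCell_subset_cell hL hM x)
  rw [cell_eq_iUnion_torusCell hL hM]
  exact integral_iUnion_fintype (fun x => measurableSet_torusCell M _ x)
    (pairwise_disjoint_torusCell M (div_pos hL hMpos)) hsub

/-- `∫⁻_{[0,L)³} G = Σ_y ∫⁻_{C_y} G`. [folklore] -/
theorem setLIntegral_cell_eq_sum (hL : 0 < L) (hM : 1 ≤ M) (G : Space → ℝ≥0∞) :
    ∫⁻ η in cell L, G η = ∑ y : Fin 3 → Fin M, ∫⁻ η in torusCell M (L / M) y, G η := by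
  have hMpos : (0 : ℝ) < M := by exact_mod_cast hM
  rw [cell_eq_iUnion_torusCell hL hM, lintegral_iUnion (fun y => measurableSet_torusCell M _ y)
    (pairwise_disjoint_torusCell M (div_pos hL hMpos)), tsum_fintype]

end Cells

/-! ## The tagged pair: continuity and Bose symmetry -/

section Pair

variable {N' : ℕ} {L : ℝ}

/-- `(ξ, η) ↦ (ξ, η, X')` is continuous. [folklore] -/
theorem continuous_pairConfig (X' : Config N') :
    Continuous fun p : Space × Space => pairConfig p.1 p.2 X' :=
  show Continuous fun p : Space × Space => Matrix.vecCons p.1 (Matrix.vecCons p.2 X') from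
    continuous_fst.matrixVecCons (continuous_snd.matrixVecCons continuous_const)

/-- Swapping the tagged pair: `(η, ξ, X') ∘ (0 1) = (ξ, η, X')`. [folklore] -/
theorem pairConfig_comp_swap (ξ η : Space) (X' : Config N') :
    pairConfig η ξ X' ∘ (Equiv.swap (0 : Fin (N' + 2)) (Fin.succ 0)) = pairConfig ξ η X' := by
  funext i
  simp only [Function.comp_apply]
  refine Fin.cases ?_ (fun j => ?_) i
  · rw [Equiv.swap_apply_left]
    simp [pairConfig]
  · refine Fin.cases ?_ (fun k => ?_) j
    · rw [Equiv.swap_apply_right]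
      simp [pairConfig]
    · rw [Equiv.swap_apply_of_ne_of_ne (Fin.succ_ne_zero _)
        (fun h => Fin.succ_ne_zero k (Fin.succ_injective _ h))]
      simp [pairConfig]

/-- Bose symmetry in the tagged pair: `Ψ(ξ, η, X') = Ψ(η, ξ, X')`. [folklore] -/
theorem psi_pairConfig_swap (Ψ : PeriodicTrialState (N' + 2) L) (ξ η : Space) (X' : Config N') :
    Ψ.ψ (pairConfig ξ η X') = Ψ.ψ (pairConfig η ξ X') := by
  have h := Ψ.symm (Equiv.swap 0 (Fin.succ 0)) (pairConfig η ξ X')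
  rwa [pairConfig_comp_swap] at h

end Pair

/-! ## The estimate at fixed background `X'` -/

section Fixed

variable {N' M : ℕ} {L : ℝ}

/-- The cell-integrated slice `η ↦ ∫_{[0,L)³} Ψ(ξ, η, X') dξ` is integrable on every `C_y`. [folklore] -/
theorem integrableOn_sliceIntegral (hL : 0 < L) (hM : 1 ≤ M) (Ψ : PeriodicTrialState (N' + 2) L)
    (X' : Config N') (y : Fin 3 → Fin M) :
    IntegrableOn (fun η => ∫ ξ in cell L, Ψ.ψ (pairConfig ξ η X')) (torusCell M (L / M) y)
      volume :=
  integrableOn_setIntegral_of_continuous (G := fun p : Space × Space => Ψ.ψ (pairConfig p.2 p.1 X'))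
    (Ψ.contDiff.continuous.comp ((continuous_pairConfig X').comp continuous_swap))
    (torusCell_subset_cell hL hM y) subset_rfl

/-- **Fubini bookkeeping + Bose symmetry**: the real part of `∫_{C_y} ∫_{[0,L)³} Ψ(ξ, η, X') dξ dη`
is the cell field `r_{X'}(y) = Σ_x K_{X'}(y, x)`. [folklore] -/
theorem re_setIntegral_sliceIntegral (hL : 0 < L) (hM : 1 ≤ M) (Ψ : PeriodicTrialState (N' + 2) L)
    (X' : Config N') (y : Fin 3 → Fin M) :
    (∫ η in torusCell M (L / M) y, ∫ ξ in cell L, Ψ.ψ (pairConfig ξ η X')).re =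
      cellField L M Ψ.ψ X' y := by
  have hcont := Ψ.contDiff.continuous
  have hsub := fun x : Fin 3 → Fin M => torusCell_subset_cell hL hM x
  have hG : Continuous fun p : Space × Space => Ψ.ψ (pairConfig p.2 p.1 X') :=
    hcont.comp ((continuous_pairConfig X').comp continuous_swap)
  have hGre : Continuous fun p : Space × Space => (Ψ.ψ (pairConfig p.2 p.1 X')).re :=
    Complex.continuous_re.comp hG
  have hslice : ∀ η : Space, Continuous fun ξ : Space => Ψ.ψ (pairConfig ξ η X') := fun η =>
    hcont.comp ((continuous_pairConfig X').comp (continuous_id.prodMk continuous_const))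
  rw [← RCLike.re_to_complex, ← integral_re (integrableOn_sliceIntegral hL hM Ψ X' y)]
  have h2 : ∀ η : Space, RCLike.re (∫ ξ in cell L, Ψ.ψ (pairConfig ξ η X')) =
      ∑ x : Fin 3 → Fin M, ∫ ξ in torusCell M (L / M) x, (Ψ.ψ (pairConfig ξ η X')).re := by
    intro η
    rw [← integral_re (integrableOn_cell (hslice η))]
    simp only [RCLike.re_to_complex]
    exact setIntegral_cell_eq_sum hL hM (integrableOn_cell (Complex.continuous_re.comp (hslice η)))
  simp only [h2]
  rw [integral_finsetSum _ fun x _ =>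
    integrableOn_setIntegral_of_continuous hGre (hsub y) (hsub x)]
  unfold cellField cellKernel
  refine Finset.sum_congr rfl fun x _ => ?_
  refine setIntegral_congr_fun (measurableSet_torusCell M _ y) fun η _ => ?_
  refine setIntegral_congr_fun (measurableSet_torusCell M _ x) fun ξ _ => ?_
  simp only
  rw [psi_pairConfig_swap Ψ ξ η X']

/-- **Per-cell bound** (Cauchy–Schwarz on `C_y` and `|z|² ≥ (Re z)²`):
`b⁻³ r_{X'}(y)² ≤ ∫_{C_y} |∫_{[0,L)³} Ψ(ξ, η, X') dξ|² dη`. [folklore] -/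
theorem cell_term_bound (hL : 0 < L) (hM : 1 ≤ M) (Ψ : PeriodicTrialState (N' + 2) L)
    (X' : Config N') (y : Fin 3 → Fin M) :
    ENNReal.ofReal (((L / M) ^ 3)⁻¹ * cellField L M Ψ.ψ X' y ^ 2) ≤
      ∫⁻ η in torusCell M (L / M) y,
        (‖∫ ξ in cell L, Ψ.ψ (pairConfig ξ η X')‖₊ : ℝ≥0∞) ^ 2 := by
  have hMpos : (0 : ℝ) < M := by exact_mod_cast hM
  have hb : 0 < L / M := div_pos hL hMpos
  have hb3 : ENNReal.ofReal (L / M) ^ 3 ≠ 0 := pow_ne_zero _ (by simpa using hb)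
  have hb3' : ENNReal.ofReal (L / M) ^ 3 ≠ ⊤ := ENNReal.pow_ne_top ENNReal.ofReal_ne_top
  have h1 : cellField L M Ψ.ψ X' y ^ 2 ≤
      ‖∫ η in torusCell M (L / M) y, ∫ ξ in cell L, Ψ.ψ (pairConfig ξ η X')‖ ^ 2 := by
    rw [← re_setIntegral_sliceIntegral hL hM Ψ X' y]
    exact sq_le_sq' (abs_le.1 (Complex.abs_re_le_norm _)).1 (abs_le.1 (Complex.abs_re_le_norm _)).2
  have h2 := sq_nnnorm_setIntegral_le (μ := volume)
    (integrableOn_sliceIntegral hL hM Ψ X' y).aestronglyMeasurable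
  rw [volume_torusCell] at h2
  calc ENNReal.ofReal (((L / M) ^ 3)⁻¹ * cellField L M Ψ.ψ X' y ^ 2)
      = (ENNReal.ofReal (L / M) ^ 3)⁻¹ * ENNReal.ofReal (cellField L M Ψ.ψ X' y ^ 2) := by
        rw [ENNReal.ofReal_mul (by positivity), ENNReal.ofReal_inv_of_pos (by positivity),
          ENNReal.ofReal_pow hb.le]
    _ ≤ (ENNReal.ofReal (L / M) ^ 3)⁻¹ *
          (‖∫ η in torusCell M (L / M) y, ∫ ξ in cell L, Ψ.ψ (pairConfig ξ η X')‖₊ : ℝ≥0∞) ^ 2 := by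
        rw [coe_nnnorm_sq_eq_ofReal]
        gcongr
    _ ≤ (ENNReal.ofReal (L / M) ^ 3)⁻¹ * (ENNReal.ofReal (L / M) ^ 3 *
          ∫⁻ η in torusCell M (L / M) y,
            (‖∫ ξ in cell L, Ψ.ψ (pairConfig ξ η X')‖₊ : ℝ≥0∞) ^ 2) := by
        gcongr
    _ = _ := by rw [← mul_assoc, ENNReal.inv_mul_cancel hb3 hb3', one_mul]

/-- **Fixed-background bound**: `b⁻³ Σ_y r_{X'}(y)² ≤ ∫_{[0,L)³} |∫_{[0,L)³} Ψ(ξ, η, X') dξ|² dη`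
(the cells tile the `η`-cell; sum the per-cell bounds). [folklore] -/
theorem background_bound (hL : 0 < L) (hM : 1 ≤ M) (Ψ : PeriodicTrialState (N' + 2) L)
    (X' : Config N') :
    ENNReal.ofReal (((L / M) ^ 3)⁻¹ * ∑ y, cellField L M Ψ.ψ X' y ^ 2) ≤
      ∫⁻ η in cell L, (‖∫ ξ in cell L, Ψ.ψ (pairConfig ξ η X')‖₊ : ℝ≥0∞) ^ 2 := by
  rw [Finset.mul_sum, ENNReal.ofReal_sum_of_nonneg (fun y _ => by positivity),
    setLIntegral_cell_eq_sum hL hM]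
  exact Finset.sum_le_sum fun y _ => cell_term_bound hL hM Ψ X' y

end Fixed

end CellPairSumRule

open CellPairSumRule in
/-- **S3 — cell pair sum rule, "≥" direction.** For every periodic trial state of `N'+2` bosons on
the torus of side `L > 0` cut into `M ≥ 1` cells per side (`b = L/M`):
`(N'+2)·M⁻³·b⁻⁶·I_r ≤ ⟨Ψ, n₀Ψ⟩`. [PenroseOnsager1956; Fournais2020 (1.3)–(1.5)] -/
theorem stub_cellPairSumRule : Sig.stub_cellPairSumRule := by
  intro N' L M hL hM Ψ
  have hMpos : (0 : ℝ) < M := by exact_mod_cast hM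
  have hb : 0 < L / M := div_pos hL hMpos
  have hcont := Ψ.contDiff.continuous
  -- the constant-mode occupation through slices, tagged pair split off
  have hocc : condensateOccupation (N' + 2) L Ψ.ψ = (↑(N' + 1) + 1 : ℝ≥0∞) *
      ((ENNReal.ofReal L ^ 3)⁻¹ * ∫⁻ X' in cellN N' L, ∫⁻ η in cell L,
        (‖∫ ξ in cell L, Ψ.ψ (pairConfig ξ η X')‖₊ : ℝ≥0∞) ^ 2) := by
    have h1 := condensateOccupation_succ hL Ψ.ψ
    have h2 := lintegral_cellN_succ (n := N') L (measurable_sliceMeanSq L hcont)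
    rw [h2] at h1
    exact h1
  -- the real constant
  have hconst : ((N' : ℝ) + 2) * ((M : ℝ) ^ 3)⁻¹ * ((L / M) ^ 6)⁻¹ * fieldMass L M Ψ.ψ =
      ((N' : ℝ) + 2) * ((L ^ 3)⁻¹ * (((L / M) ^ 3)⁻¹ * fieldMass L M Ψ.ψ)) := by
    field_simp
  have hN : ENNReal.ofReal ((N' : ℝ) + 2) = (↑(N' + 1) + 1 : ℝ≥0∞) := by
    rw [show ((N' : ℝ) + 2) = ((N' + 2 : ℕ) : ℝ) by push_cast; ring, ENNReal.ofReal_natCast]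
    push_cast
    ring
  have hLinv : ENNReal.ofReal ((L ^ 3)⁻¹) = (ENNReal.ofReal L ^ 3)⁻¹ := by
    rw [ENNReal.ofReal_inv_of_pos (by positivity), ENNReal.ofReal_pow hL.le]
  rw [hocc, hconst, ENNReal.ofReal_mul (by positivity), ENNReal.ofReal_mul (by positivity), hN,
    hLinv]
  gcongr
  -- `ofReal (b⁻³ I_r) ≤ ∫⁻_{X'} ofReal (b⁻³ Σ_y r²) ≤ ∫⁻_{X'} ∫⁻_{η} |∫_ξ Ψ|²`
  unfold fieldMass
  rw [← integral_const_mul]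
  calc ENNReal.ofReal (∫ X' in cellN N' L, ((L / M) ^ 3)⁻¹ * ∑ x, cellField L M Ψ.ψ X' x ^ 2)
      ≤ ∫⁻ X' in cellN N' L, ENNReal.ofReal (((L / M) ^ 3)⁻¹ * ∑ x, cellField L M Ψ.ψ X' x ^ 2) :=
        ofReal_integral_le_lintegral_ofReal fun X' => by positivity
    _ ≤ _ := lintegral_mono fun X' => background_bound hL hM Ψ X'

end Summit.AtomisticToContinuum.BoseEinsteinCondensation.Cruxes.LatticeToPeriodicBridge.CoarseCellLorentzian

end
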